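import Mathlib
import HarnessLib
import Summits.AtomisticToContinuum.Crystallization.Theorems.FrustratedLawDichotomyTwoShellRigidityLsFitReplay

/-!
# Two-shell rigidity, slot 3 · the `SphericalLsFit` replay engine (2): box-level soundness
# (decomp-a2c, lens 3, gen 37 — NODE «SphericalLsFitReplay»)

Sequel of `…LsFitReplay`.  The hypotheses a fit run carries for a configuration `x` in frame
coordinates (`BraceHolds`: the `√2`-pairs have `|S²·⟪x i, x j⟫| ≤ B2`; `CutsHold`: the accumulated
cuts; `AllPlaced` once cuts exist), the soundness of the extended rows (`braceRows_hold`,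
`cutRow_holds`, `rowsF_hold`), of the certified values of integer functionals (`valUpper_sound`,
`valLower_sound`), and of the box-transforming instructions against the extended rows
(`applyBoundF_sound` — incl. preservation of placement —, `applyBoundF_ne_verified`, `pruneF_sound`) — verbatim the
discipline of `…RigPairs`.  `[folklore]`; no `sorry`; no `instance`/`notation`; no data.
-/

namespace Summit.AtomisticToContinuum.Crystallization.Theorems

namespace Rig

open Literature.Analysis.ValidatedNumerics.NumericsMP
open scoped Matrix

/-! ### The hypotheses of a fit run -/

/-- The brace hypotheses: every `√2`-pair of the model has `−B2 ≤ S²·(x i ⬝ x j) ≤ B2`. -/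
def BraceHolds (m : Model) (B2 : ℤ) (x : Fin 12 → Fin 3 → ℝ) : Prop :=
  ∀ i j, m.brace i j = true →
    -(B2 : ℝ) ≤ (SC : ℝ) * SC * (x i ⬝ᵥ x j) ∧ (SC : ℝ) * SC * (x i ⬝ᵥ x j) ≤ (B2 : ℝ)

/-- The real value `Σ_{v,k} g v k · x v k` of an integer coefficient field on a configuration. -/
def fval (g : Fin 12 → Fin 3 → ℤ) (x : Fin 12 → Fin 3 → ℝ) : ℝ := ∑ v, ∑ k, (g v k : ℝ) * x v k

/-- A cut holds for `x`: `S · Σ a·x ≤ ub`. -/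
def Cut.Holds (c : Cut) (x : Fin 12 → Fin 3 → ℝ) : Prop := (SC : ℝ) * fval c.a x ≤ (c.ub : ℝ)

/-- All accumulated cuts hold. -/
def CutsHold (cuts : List Cut) (x : Fin 12 → Fin 3 → ℝ) : Prop := ∀ c ∈ cuts, c.Holds x

/-- Every point is placed. -/
def AllPlaced (bx : Boxes) : Prop := ∀ v, bx.placed v = true

/-- `x` lies in one of the two closed half-spaces of a cut. -/
theorem cut_dichotomy (c : Cut) (x : Fin 12 → Fin 3 → ℝ) : c.Holds x ∨ c.neg.Holds x := by
  unfold Cut.Holds Cut.neg fval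
  simp only
  push_cast
  simp only [neg_mul, Finset.sum_neg_distrib, mul_neg]
  rcases le_total ((SC : ℝ) * ∑ v, ∑ k, (c.a v k : ℝ) * x v k) (c.ub : ℝ) with h | h
  · exact Or.inl h
  · exact Or.inr (by linarith)

/-- The all-placed test of the checker means `AllPlaced`. -/
theorem allPlaced_of_all {bx : Boxes} (h : (List.finRange 12).all (fun v => bx.placed v) = true) :
    AllPlaced bx := by
  intro v
  rw [List.all_eq_true] at h
  exact h v (List.mem_finRange v)

/-- Placement is preserved by updating a point with a box. -/
theorem placed_update {bx : Boxes} (v : Fin 12) (B : IVec) {w : Fin 12} (hw : bx.placed w = true) :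
    Boxes.placed (Function.update bx v (some B)) w = true := by
  unfold Boxes.placed at hw ⊢
  by_cases h : w = v
  · subst h; rw [Function.update_self]; rfl
  · rw [Function.update_of_ne h]; exact hw

/-! ### The displacement sum of an integer functional -/

/-- With all points placed, `Σ g·d = Σ g·x − (Σ g·C)/S`. -/
theorem sum_disp_eq {bx : Boxes} {x : Fin 12 → Fin 3 → ℝ} (hall : AllPlaced bx)
    (g : Fin 12 → Fin 3 → ℤ) :
    (∑ v, ∑ k, (g v k : ℝ) * bx.disp x v k) = fval g x - (centreVal bx g : ℝ) / SC := by
  unfold fval centreVal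
  push_cast
  rw [Finset.sum_div, ← Finset.sum_sub_distrib]
  refine Finset.sum_congr rfl fun v _ => ?_
  rw [Finset.sum_div, ← Finset.sum_sub_distrib]
  refine Finset.sum_congr rfl fun k _ => ?_
  rw [Boxes.coord_eq (x := x) (hall v) k]
  unfold Boxes.c
  ring

/-! ### Brace rows hold -/

/-- The upper brace row holds. -/
theorem braceUpper_holds {bx : Boxes} {x : Fin 12 → Fin 3 → ℝ} {i j : Fin 12} {B2 : ℤ}
    (hle : (SC : ℝ) * SC * (x i ⬝ᵥ x j) ≤ (B2 : ℝ)) (hx : bx.mem x)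
    (hi : bx.placed i = true) (hj : bx.placed j = true) :
    (⟨pairCoeff bx i j, B2 - c0 bx i j + rem bx i j⟩ : Row).Holds (bx.disp x) := by
  have hS : (0 : ℝ) < SC := by exact_mod_cast SC_pos
  have hd := Boxes.dispIn_of_mem hx
  have hexp := inner_expand (x := x) hi hj
  have hremle := neg_rem_le hd i j
  unfold Row.Holds
  rw [sum_pairCoeff, le_div_iff₀ hS]
  push_cast
  nlinarith [hexp, hle, hremle]

/-- Both brace rows of a placed `√2`-pair hold. -/
theorem bracePairRows_hold {m : Model} {B2 : ℤ} {bx : Boxes} {x : Fin 12 → Fin 3 → ℝ}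
    (hB : BraceHolds m B2 x) (hx : bx.mem x) {i j : Fin 12} (hb : m.brace i j = true)
    (hi : bx.placed i = true) (hj : bx.placed j = true) :
    ∀ r ∈ bracePairRows B2 bx i j, r.Holds (bx.disp x) := by
  obtain ⟨hlo, hhi⟩ := hB i j hb
  intro r hr
  unfold bracePairRows at hr
  simp only [List.mem_cons, List.mem_nil_iff, or_false] at hr
  rcases hr with rfl | rfl
  · exact braceUpper_holds hhi hx hi hj
  · refine targetRow_holds ?_ hx hi hj
    push_cast
    exact hlo

/-- **Every brace row holds.** -/
theorem braceRows_hold {m : Model} {B2 : ℤ} {bx : Boxes} {x : Fin 12 → Fin 3 → ℝ}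
    (hB : BraceHolds m B2 x) (hx : bx.mem x) : ∀ r ∈ braceRows m B2 bx, r.Holds (bx.disp x) := by
  intro r hr
  unfold braceRows at hr
  rw [List.mem_flatMap] at hr
  obtain ⟨⟨i, j⟩, hp, hr⟩ := hr
  have hb : m.brace i j = true := by
    unfold bracePairs at hp
    rw [List.mem_filter] at hp
    exact hp.2
  simp only at hr
  by_cases hpl : (bx.placed i && bx.placed j) = true
  · rw [if_pos hpl] at hr
    rw [Bool.and_eq_true] at hpl
    exact bracePairRows_hold hB hx hb hpl.1 hpl.2 r hr
  · rw [if_neg hpl] at hr; exact absurd hr (by simp)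

/-! ### Cut rows hold -/

/-- **A cut row holds** (all points placed). -/
theorem cutRow_holds {bx : Boxes} {x : Fin 12 → Fin 3 → ℝ} (hall : AllPlaced bx) {c : Cut}
    (hc : c.Holds x) : (cutRow bx c).Holds (bx.disp x) := by
  have hS : (0 : ℝ) < SC := by exact_mod_cast SC_pos
  unfold Row.Holds cutRow
  simp only
  rw [sum_disp_eq hall c.a, le_div_iff₀ hS, sub_mul, div_mul_cancel₀ _ hS.ne']
  push_cast
  unfold Cut.Holds at hc
  linarith

/-- **Every cut row holds.** -/
theorem cutRows_hold {bx : Boxes} {x : Fin 12 → Fin 3 → ℝ} {cuts : List Cut}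
    (hcuts : CutsHold cuts x) (hall : cuts ≠ [] → AllPlaced bx) :
    ∀ r ∈ cuts.map (cutRow bx), r.Holds (bx.disp x) := by
  intro r hr
  rw [List.mem_map] at hr
  obtain ⟨c, hc, rfl⟩ := hr
  have hne : cuts ≠ [] := List.ne_nil_of_mem hc
  exact cutRow_holds (hall hne) (hcuts c hc)

/-- **Every extended row holds** for a feasible braced configuration satisfying the cuts. -/
theorem rowsF_hold {m : Model} {prm : FitPrm} {bx : Boxes} {cuts : List Cut} {x : Fin 12 → Fin 3 → ℝ}
    (hF : Feasible m.bond x) (hB : BraceHolds m prm.B2 x) (hx : bx.mem x) (hcuts : CutsHold cuts x)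
    (hall : cuts ≠ [] → AllPlaced bx) : ∀ r ∈ rowsOfF m prm bx cuts, r.Holds (bx.disp x) := by
  intro r hr
  unfold rowsOfF at hr
  rw [List.mem_append, List.mem_append] at hr
  rcases hr with (hr | hr) | hr
  · exact rows_hold hF hx r hr
  · exact braceRows_hold hB hx r hr
  · exact cutRows_hold hcuts hall r hr

/-- The array form. -/
theorem rowsF_hold_arr {m : Model} {prm : FitPrm} {bx : Boxes} {cuts : List Cut}
    {x : Fin 12 → Fin 3 → ℝ} (hF : Feasible m.bond x) (hB : BraceHolds m prm.B2 x) (hx : bx.mem x)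
    (hcuts : CutsHold cuts x) (hall : cuts ≠ [] → AllPlaced bx) :
    ∀ r ∈ (rowsOfF m prm bx cuts).toArray, r.Holds (bx.disp x) :=
  fun r hr => rowsF_hold hF hB hx hcuts hall r (List.mem_toArray.1 hr)

/-! ### Certified values of integer functionals -/

/-- **`S·(Σ g·x) ≤ valUpper`** whenever the rows hold for the displacement of `x` (all placed). -/
theorem valUpper_sound {bx : Boxes} {rows : Array Row} {x : Fin 12 → Fin 3 → ℝ}
    (hrows : ∀ r ∈ rows, r.Holds (bx.disp x)) (hx : bx.mem x) (hall : AllPlaced bx)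
    (g : Fin 12 → Fin 3 → ℤ) (cert : Cert) :
    (SC : ℝ) * fval g x ≤ (valUpper bx rows g cert : ℝ) := by
  have hS : (0 : ℝ) < SC := by exact_mod_cast SC_pos
  have h := certUpper_sound hrows (Boxes.dispIn_of_mem hx) g cert
  rw [sum_disp_eq hall g, le_div_iff₀ hS, sub_mul, div_mul_cancel₀ _ hS.ne'] at h
  unfold valUpper
  push_cast
  linarith

/-- **`valLower ≤ S·(Σ g·x)`.** -/
theorem valLower_sound {bx : Boxes} {rows : Array Row} {x : Fin 12 → Fin 3 → ℝ}
    (hrows : ∀ r ∈ rows, r.Holds (bx.disp x)) (hx : bx.mem x) (hall : AllPlaced bx)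
    (g : Fin 12 → Fin 3 → ℤ) (cert : Cert) :
    (valLower bx rows g cert : ℝ) ≤ (SC : ℝ) * fval g x := by
  have hS : (0 : ℝ) < SC := by exact_mod_cast SC_pos
  have h := certUpper_sound hrows (Boxes.dispIn_of_mem hx) (fun v k => -g v k) cert
  rw [sum_disp_eq hall (fun v k => -g v k), le_div_iff₀ hS, sub_mul, div_mul_cancel₀ _ hS.ne'] at h
  have hneg : fval (fun v k => -g v k) x = -fval g x := by
    unfold fval; push_cast; simp only [neg_mul, Finset.sum_neg_distrib]
  have hnegC : (centreVal bx (fun v k => -g v k) : ℝ) = -(centreVal bx g : ℝ) := by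
    unfold centreVal; push_cast; simp only [neg_mul, Finset.sum_neg_distrib]
  rw [hneg, hnegC] at h
  unfold valLower
  push_cast
  linarith

/-! ### Soundness of the box-transforming instructions -/

/-- **Soundness of `applyBoundF`** (as `applyBoundT_sound`, against the extended rows; the new boxes keep every placed point placed). -/
theorem applyBoundF_sound {m : Model} {prm : FitPrm} {x : Fin 12 → Fin 3 → ℝ}
    (hF : Feasible m.bond x) (hB : BraceHolds m prm.B2 x) {bx : Boxes} (hx : bx.mem x)
    {cuts : List Cut} (hcuts : CutsHold cuts x) (hall : cuts ≠ [] → AllPlaced bx) (st : List Step)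
    (v : Fin 12) (k : Fin 3) (up : Bool) (cert : Cert) :
    applyBoundF m prm bx st cuts v k up cert ≠ Outcome.pruned ∧
    ∀ bx' st', applyBoundF m prm bx st cuts v k up cert = Outcome.running bx' st' →
      bx'.mem x ∧ st' = st ∧ (∀ w, bx.placed w = true → bx'.placed w = true) := by
  have hS : (0 : ℝ) < SC := by exact_mod_cast SC_pos
  unfold applyBoundF
  cases hv : bx v with
  | none => simp
  | some B =>
    simp only
    have hrows := rowsF_hold_arr hF hB hx hcuts hall
    have hd := Boxes.dispIn_of_mem hx
    have hU := certUpper_sound hrows hd (unitObj v k up) cert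
    rw [sum_unitObj] at hU
    set U := certUpper bx (rowsOfF m prm bx cuts).toArray (unitObj v k up) cert
    have hplaced : bx.placed v = true := by simp [Boxes.placed, hv]
    have hdisp : bx.disp x v k = x v k - bx.c v k := by simp [Boxes.disp, hplaced]
    have hxk := hx v B hv k
    rw [← Boxes.ivl_of_some hv k] at hxk
    obtain ⟨hlo, hhi⟩ := hxk
    have hwin : (if up then x v k * SC ≤ (bx.C v k : ℝ) + U
        else (bx.C v k : ℝ) - U ≤ x v k * SC) := by
      unfold Boxes.c at hdisp
      cases up with
      | true =>
        simp only [if_true, one_mul] at hU ⊢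
        rw [hdisp, le_div_iff₀ hS] at hU
        have : (x v k - (bx.C v k : ℝ) / SC) * SC = x v k * SC - bx.C v k := by field_simp
        linarith [hU, this]
      | false =>
        simp only [Bool.false_eq_true, if_false, neg_one_mul] at hU ⊢
        rw [hdisp, le_div_iff₀ hS] at hU
        have : -(x v k - (bx.C v k : ℝ) / SC) * SC = -(x v k * SC) + bx.C v k := by
          field_simp; ring
        linarith [hU, this]
    set I' : MI := if up then ⟨(B.get k).lo, min (B.get k).hi (bx.C v k + U)⟩
      else ⟨max (B.get k).lo (bx.C v k - U), (B.get k).hi⟩ with hI'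
    have hmemI' : MI.mem SC (x v k) I' := by
      rw [Boxes.ivl_of_some hv k] at hlo hhi
      cases up with
      | true =>
        simp only [if_true] at hwin hI'
        rw [hI']
        refine ⟨hlo, ?_⟩
        push_cast
        exact le_min hhi hwin
      | false =>
        simp only [Bool.false_eq_true, if_false] at hwin hI'
        rw [hI']
        refine ⟨?_, hhi⟩
        push_cast
        exact max_le hlo hwin
    constructor
    · intro hpr
      by_cases hlt : I'.hi < I'.lo
      · have h1 := hmemI'.1; have h2 := hmemI'.2
        have : (I'.hi : ℝ) < I'.lo := by exact_mod_cast hlt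
        linarith
      · rw [if_neg hlt] at hpr; exact absurd hpr (by simp)
    · intro bx' st' hrun
      by_cases hlt : I'.hi < I'.lo
      · rw [if_pos hlt] at hrun; exact absurd hrun (by simp)
      · rw [if_neg hlt] at hrun
        simp only [Outcome.running.injEq] at hrun
        obtain ⟨rfl, rfl⟩ := hrun
        refine ⟨mem_update hx v ?_, rfl, fun w hw => placed_update v _ hw⟩
        intro l
        simp only [IVec.setCoord, IVec.get_ofFn]
        by_cases hl : l = k
        · subst hl; rw [if_pos rfl]; exact hmemI'
        · rw [if_neg hl]; exact hx v B hv l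

/-- `applyBoundF` never reports `verified`. -/
theorem applyBoundF_ne_verified (m : Model) (prm : FitPrm) (bx : Boxes) (st : List Step)
    (cuts : List Cut) (v : Fin 12) (k : Fin 3) (up : Bool) (cert : Cert) :
    applyBoundF m prm bx st cuts v k up cert ≠ Outcome.verified := by
  unfold applyBoundF
  cases bx v with
  | none => simp
  | some B => simp only; split_ifs <;> simp

/-- **Soundness of `prune`** against the extended rows. -/
theorem pruneF_sound {m : Model} {prm : FitPrm} {x : Fin 12 → Fin 3 → ℝ} (hF : Feasible m.bond x)
    (hB : BraceHolds m prm.B2 x) {bx : Boxes} (hx : bx.mem x) {cuts : List Cut}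
    (hcuts : CutsHold cuts x) (hall : cuts ≠ [] → AllPlaced bx) (terms : List (ℕ × ℕ)) :
    certInfeasible bx (rowsOfF m prm bx cuts).toArray terms = false := by
  by_contra h
  rw [Bool.not_eq_false] at h
  exact certInfeasible_sound (rowsF_hold_arr hF hB hx hcuts hall) (Boxes.dispIn_of_mem hx) h

end Rig

end Summit.AtomisticToContinuum.Crystallization.Theorems
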